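import Summits.KontsevichZagierPeriods.KontsevichZagierPeriods.Theorems.AbelContractionRealHyperellipticSectorDefs

/-!
# Route AbelContraction — `RealHyperellipticSector` (crux stmt-KontsevichZagierPeriods-12475): roots of the separating pencil

Helper file of the line `Lines/birth.lean` (registered brick `engine_pencil_roots` of the stub
`stub_engine`, `--supports` the crux). For an M-polynomial with real simple roots
`e 0 < e 1 < ⋯ < e (2g+1)` the SEPARATING PENCIL is `N(t) = ∏_{k ≤ g} (t − e (2k))`,
`D(t) = ∏_{k ≤ g} (t − e (2k+1))`; for `λ, u > 0` the fibre of `ψ = −λN/D` over `u` is the zero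
set of the degree-`(g+1)` polynomial `c_u(t) = λ N(t) + u D(t)`.

* `engine_pencil_roots`: `c_u` has exactly one (simple) root `x j` in each oval
  `(e (2j), e (2j+1))`, `j = 0, …, g`, the roots are increasing, and
  `c_u(t) = (λ + u) ∏_j (t − x j)`. Proof: at the oval ends `c_u (e (2j)) = u · D (e (2j))` and
  `c_u (e (2j+1)) = λ · N (e (2j+1))` have opposite signs (the product
  `D (e (2j)) · N (e (2j+1)) = ∏_k (e (2j) − e (2k+1)) (e (2j+1) − e (2k))` has exactly one negative
  factor, `k = j`), so the intermediate value theorem gives a root in each open oval; the `g + 1`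
  distinct roots exhaust the roots of `c_u` (degree `g + 1`, leading coefficient `λ + u`), whence
  the factorisation (`Polynomial.C_leadingCoeff_mul_prod_multiset_X_sub_C`).

References: M. Kontsevich, D. Zagier, *Periods* (2001), §1.2 [KontsevichZagier2001];
B. Gross, J. Harris, *Real algebraic curves*, Ann. Sci. ÉNS 14 (1981), §3 [GrossHarris1981].
No definitions are introduced.
-/

noncomputable section

open Set
open scoped Polynomial
open Literature.NumberTheory.Transcendental

namespace Summit.KontsevichZagierPeriods.AbelContraction.RealHyperellipticSector

namespace PencilRoots

/-- **Sign change of the pencil at the ends of an oval**: for `e` strictly increasing and `j ≤ g`,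
`(∏_{k ≤ g} (e (2j) − e (2k+1))) · ∏_{k ≤ g} (e (2j+1) − e (2k)) < 0` — pairing the factors with the
same `k`, every pair `(e (2j) − e (2k+1)) (e (2j+1) − e (2k))` with `k ≠ j` is a product of two
numbers of the same sign, and the pair `k = j` is negative. [folklore] -/
theorem endpoint_prod_neg (g : ℕ) (e : ℕ → ℝ) (he : StrictMono e) (j : ℕ) (hj : j < g + 1) :
    (∏ k ∈ Finset.range (g + 1), (e (2 * j) - e (2 * k + 1))) *
      ∏ k ∈ Finset.range (g + 1), (e (2 * j + 1) - e (2 * k)) < 0 := by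
  rw [← Finset.prod_mul_distrib, ← Finset.mul_prod_erase _ _ (Finset.mem_range.mpr hj)]
  refine mul_neg_of_neg_of_pos
    (mul_neg_of_neg_of_pos (sub_neg.mpr (he (by omega))) (sub_pos.mpr (he (by omega))))
    (Finset.prod_pos fun k hk => ?_)
  rcases lt_or_gt_of_ne (Finset.ne_of_mem_erase hk) with hlt | hlt
  · exact mul_pos (sub_pos.mpr (he (by omega))) (sub_pos.mpr (he (by omega)))
  · exact mul_pos_of_neg_of_neg (sub_neg.mpr (he (by omega))) (sub_neg.mpr (he (by omega)))

/-- **A continuous function with a sign change has a zero in the open interval**: if `f` is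
continuous, `a < b` and `f a · f b < 0`, then `f x = 0` for some `x ∈ (a, b)` (intermediate value
theorem). [folklore] -/
theorem exists_zero_of_mul_neg {f : ℝ → ℝ} (hf : Continuous f) {a b : ℝ} (hab : a < b)
    (h : f a * f b < 0) : ∃ x, (a < x ∧ x < b) ∧ f x = 0 := by
  rcases mul_neg_iff.mp h with ⟨ha, hb⟩ | ⟨ha, hb⟩
  · obtain ⟨x, hx, hx0⟩ := intermediate_value_Ioo' hab.le hf.continuousOn ⟨hb, ha⟩
    exact ⟨x, hx, hx0⟩
  · obtain ⟨x, hx, hx0⟩ := intermediate_value_Ioo hab.le hf.continuousOn ⟨ha, hb⟩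
    exact ⟨x, hx, hx0⟩

/-- **A real polynomial with the full number of listed distinct roots factors through them**:
if `P ∈ ℝ[X]` has `natDegree P ≤ n`, `P ≠ 0`, and `x : Fin n → ℝ` is injective with
`P (x j) = 0` for all `j`, then `P(t) = lc · ∏_j (t − x j)` for every real `t` (`lc` the leading
coefficient): the `n` distinct roots exhaust the `≤ n` roots of `P` counted with multiplicity.
[folklore] -/
theorem eval_eq_leadingCoeff_mul_prod {n : ℕ} (P : ℝ[X]) (hP0 : P ≠ 0) (hdeg : P.natDegree ≤ n)
    (x : Fin n → ℝ) (hx : Function.Injective x) (hroot : ∀ j, P.eval (x j) = 0) (t : ℝ) :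
    P.eval t = P.leadingCoeff * ∏ j : Fin n, (t - x j) := by
  obtain ⟨S, hS⟩ : ∃ S : Multiset ℝ, S = (Finset.univ : Finset (Fin n)).val.map x := ⟨_, rfl⟩
  have hSnd : S.Nodup := hS ▸ Finset.univ.nodup.map hx
  have hScard : Multiset.card S = n := by
    rw [hS, Multiset.card_map, Finset.card_val, Finset.card_univ, Fintype.card_fin]
  have hle : S ≤ P.roots := by
    refine (Multiset.le_iff_subset hSnd).mpr fun a ha => ?_
    rw [hS, Multiset.mem_map] at ha
    obtain ⟨j, -, rfl⟩ := ha
    exact (Polynomial.mem_roots hP0).mpr (hroot j)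
  have hcard : Multiset.card P.roots = P.natDegree := by
    refine le_antisymm (Polynomial.card_roots' P) (hdeg.trans ?_)
    rw [← hScard]
    exact Multiset.card_le_card hle
  have hSeq : S = P.roots :=
    Multiset.eq_of_le_of_card_le hle
      (by rw [hcard, hScard]; exact hdeg)
  have hprod := Polynomial.C_leadingCoeff_mul_prod_multiset_X_sub_C hcard
  rw [← hSeq] at hprod
  have h := congrArg (Polynomial.eval t) hprod
  rw [← h, Polynomial.eval_mul, Polynomial.eval_C, Polynomial.eval_multiset_prod, hS,
    Multiset.map_map, Multiset.map_map, Finset.prod_eq_multiset_prod]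
  simp only [Function.comp_def, Polynomial.eval_sub, Polynomial.eval_X, Polynomial.eval_C]

end PencilRoots

open Polynomial in
/-- **Roots of the separating pencil** (brick `engine_pencil_roots` of `stub_engine`): for
`e` strictly increasing and `λ, u > 0`, the pencil polynomial
`c_u(t) = λ ∏_{k ≤ g} (t − e (2k)) + u ∏_{k ≤ g} (t − e (2k+1))` has one root `x j` in each oval
`(e (2j), e (2j+1))`, `j = 0, …, g`, the roots increase with `j`, and
`c_u(t) = (λ + u) ∏_j (t − x j)` identically: the values of `c_u` at the two ends of an oval have
opposite signs (intermediate value theorem), and `g + 1` distinct roots exhaust the roots of the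
degree-`(g+1)` polynomial `c_u`, whose leading coefficient is `λ + u`.
[cite: GrossHarris1981, §3] [folklore] -/
theorem engine_pencil_roots : ∀ (g : ℕ) (e : ℕ → ℝ) (lam u : ℝ), StrictMono e → 0 < lam →
    0 < u → ∃ x : Fin (g + 1) → ℝ, StrictMono x ∧
      (∀ j : Fin (g + 1), e (2 * (j : ℕ)) < x j ∧ x j < e (2 * (j : ℕ) + 1)) ∧
      ∀ t : ℝ, lam * ∏ k ∈ Finset.range (g + 1), (t - e (2 * k)) +
        u * ∏ k ∈ Finset.range (g + 1), (t - e (2 * k + 1)) =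
        (lam + u) * ∏ j : Fin (g + 1), (t - x j) := by
  intro g e lam u he hlam hu
  -- the pencil polynomial `P = C λ · N + C u · D`
  obtain ⟨N, hN⟩ : ∃ N : ℝ[X], N = ∏ k ∈ Finset.range (g + 1), (X - C (e (2 * k))) := ⟨_, rfl⟩
  obtain ⟨D, hD⟩ : ∃ D : ℝ[X], D = ∏ k ∈ Finset.range (g + 1), (X - C (e (2 * k + 1))) :=
    ⟨_, rfl⟩
  obtain ⟨P, hP⟩ : ∃ P : ℝ[X], P = C lam * N + C u * D := ⟨_, rfl⟩
  have hev : ∀ t, P.eval t = lam * ∏ k ∈ Finset.range (g + 1), (t - e (2 * k)) +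
      u * ∏ k ∈ Finset.range (g + 1), (t - e (2 * k + 1)) := fun t => by
    simp only [hP, hN, hD, eval_add, eval_mul, eval_C, eval_prod, eval_sub, eval_X]
  -- sign change on each oval, hence a root in each oval
  have hsign : ∀ j < g + 1, P.eval (e (2 * j)) * P.eval (e (2 * j + 1)) < 0 := by
    intro j hj
    have hN0 : ∏ k ∈ Finset.range (g + 1), (e (2 * j) - e (2 * k)) = 0 :=
      Finset.prod_eq_zero (Finset.mem_range.mpr hj) (sub_self (e (2 * j)))
    have hD0 : ∏ k ∈ Finset.range (g + 1), (e (2 * j + 1) - e (2 * k + 1)) = 0 :=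
      Finset.prod_eq_zero (Finset.mem_range.mpr hj) (sub_self (e (2 * j + 1)))
    rw [hev, hev, hN0, hD0, mul_zero, zero_add, mul_zero, add_zero]
    have h := PencilRoots.endpoint_prod_neg g e he j hj
    calc u * (∏ k ∈ Finset.range (g + 1), (e (2 * j) - e (2 * k + 1))) *
          (lam * ∏ k ∈ Finset.range (g + 1), (e (2 * j + 1) - e (2 * k)))
        = (u * lam) * ((∏ k ∈ Finset.range (g + 1), (e (2 * j) - e (2 * k + 1))) *
            ∏ k ∈ Finset.range (g + 1), (e (2 * j + 1) - e (2 * k))) := by ring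
      _ < 0 := mul_neg_of_pos_of_neg (mul_pos hu hlam) h
  have hex : ∀ j : Fin (g + 1), ∃ x, (e (2 * (j : ℕ)) < x ∧ x < e (2 * (j : ℕ) + 1)) ∧
      P.eval x = 0 := fun j =>
    PencilRoots.exists_zero_of_mul_neg P.continuous (he (by omega)) (hsign j j.isLt)
  choose x hxI hx0 using hex
  have hxmono : StrictMono x := by
    intro i j hij
    have hij' : (i : ℕ) < (j : ℕ) := hij
    have h1 := (hxI i).2
    have h2 := (hxI j).1
    have h3 : e (2 * (i : ℕ) + 1) ≤ e (2 * (j : ℕ)) := he.monotone (by omega)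
    linarith
  refine ⟨x, hxmono, hxI, fun t => ?_⟩
  -- degree and leading coefficient of `P`
  have hNm : N.Monic := hN ▸ monic_prod_of_monic _ _ fun k _ => monic_X_sub_C _
  have hDm : D.Monic := hD ▸ monic_prod_of_monic _ _ fun k _ => monic_X_sub_C _
  have hNdeg : N.natDegree = g + 1 := by
    rw [hN, natDegree_prod_of_monic _ _ fun k _ => monic_X_sub_C _]
    simp only [natDegree_X_sub_C, Finset.sum_const, Finset.card_range, smul_eq_mul, mul_one]
  have hDdeg : D.natDegree = g + 1 := by
    rw [hD, natDegree_prod_of_monic _ _ fun k _ => monic_X_sub_C _]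
    simp only [natDegree_X_sub_C, Finset.sum_const, Finset.card_range, smul_eq_mul, mul_one]
  have h1d : (C lam * N).degree = ((g + 1 : ℕ) : WithBot ℕ) := by
    rw [degree_C_mul hlam.ne', degree_eq_natDegree hNm.ne_zero, hNdeg]
  have h2d : (C u * D).degree = ((g + 1 : ℕ) : WithBot ℕ) := by
    rw [degree_C_mul hu.ne', degree_eq_natDegree hDm.ne_zero, hDdeg]
  have h1l : (C lam * N).leadingCoeff = lam := by
    rw [leadingCoeff_mul, leadingCoeff_C, hNm.leadingCoeff, mul_one]
  have h2l : (C u * D).leadingCoeff = u := by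
    rw [leadingCoeff_mul, leadingCoeff_C, hDm.leadingCoeff, mul_one]
  have hne : (C lam * N).leadingCoeff + (C u * D).leadingCoeff ≠ 0 := by
    rw [h1l, h2l]; positivity
  have hPlc : P.leadingCoeff = lam + u := by
    rw [hP, leadingCoeff_add_of_degree_eq (h1d.trans h2d.symm) hne, h1l, h2l]
  have hPdeg : P.natDegree = g + 1 := by
    refine natDegree_eq_of_degree_eq_some ?_
    rw [hP, degree_add_eq_of_leadingCoeff_add_ne_zero hne, h1d, h2d, max_self]
  have hP0 : P ≠ 0 := leadingCoeff_ne_zero.mp (by rw [hPlc]; positivity)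
  -- the `g + 1` distinct roots exhaust the roots of `P`
  rw [← hev, ← hPlc]
  exact PencilRoots.eval_eq_leadingCoeff_mul_prod P hP0 hPdeg.le x hxmono.injective hx0 t

end Summit.KontsevichZagierPeriods.AbelContraction.RealHyperellipticSector

end
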